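import Mathlib
import HarnessLib
import Summits.Ventures.LatticeQCDFlow.Exactness.NCMCGeneralSpaceReplicaTStatisticStudent
import Summits.Ventures.LatticeQCDFlow.Exactness.NCMCGeneralSpaceReplicaTStatisticTwoReplicas
import Summits.Ventures.LatticeQCDFlow.Exactness.NCMCGeneralSpaceReplicaTStatisticIndep
import Summits.Ventures.LatticeQCDFlow.Exactness.NCMCGeneralSpaceReplicaTStatisticCoverageChains

/-!
# Student coverage, end to end: the replica-`t` bar of `R` independent chains (any starts) or `R` independent runs covers with the Student-ratio probability; for `R = 2` that is `(2/π)·arctan q`, calibrated by `q = tan(π(1−α)/2)`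

HONEST FRAMING: exact (Metropolis-corrected) sampling algorithms for lattice gauge theory;
figures of merit are autocorrelation/cost numbers at stated couplings and volumes; no
continuum-physics claim.

Venture `LatticeQCDFlow` (cell pub-lqcd), topic `Exactness`; FANOUT row 13 (`eng-snf`, GEN-24).  NEW
WORK of the cell; composition of the tree's GEN-23/24 files: K4
`tendsto_measure_abs_replicaTStat_le_of_nHit` (chains), I `tendsto_measure_abs_studentised_le_of_indep`
(independent runs), GEN-24 `pi_gaussianReal_measure_abs_tStat_le_eq_studentRatio` (Helmert:
`L_R(q)` is the Student-ratio probability) and `gaussianReal_prod_measure_abs_le_mul_abs` (the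
`R = 2` closed form `(2/π)·arctan q`).  No definition; nothing cited as a fact (Student NAMED ONLY).

## Content
* **`tendsto_measure_abs_studentised_le_studentRatio_of_indep`** (§1) — `R ≥ 2` independent runs of
  ANY estimator with `√n(θ̂_{r,n} − θ) ⇒ N(0,v)`: coverage of `θ̄̂ ± q·ŝe_JK` →
  `N(0,1)^{⊗R}{|z_{r₀}| ≤ q √((Σ_{r ≠ r₀} z_r²)/(R−1))}`.
* **`tendsto_measure_abs_replicaTStat_le_studentRatio_of_nHit`** (§1) — the same limit for `R ≥ 2`
  independent Doeblin-power chains from ANY starts, `|f| ≤ C`, `σ²_f > 0`.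
* `pi_measure_abs_eval_le_mul_abs_eval` (§2) — two coordinates of a product law: the event
  `{|z_{r₀}| ≤ q |z_{r₁}|}` has the `(μ_{r₀} ⊗ μ_{r₁})`-probability of the cone.
* **`pi_gaussianReal_measure_abs_tStat_le_eq_arctan`** (§2) — `card ι = 2`, `q ≥ 0`, `v ≠ 0`:
  `L_2(q) = N(0,v)^{⊗2}{|t| ≤ q} = (2/π)·arctan q`.
* **`tendsto_measure_abs_replicaTStat_le_arctan_of_nHit`** (§3) — TWO independent chains from any
  starts: `P(|t_n| ≤ q) → (2/π)·arctan q`; **`…_tan_of_nHit`** — with `q = tan(π(1−α)/2)` the limit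
  is `1 − α` (the two-replica bar is calibrated by Student's `t₁` quantile, `12.706…` at 95 %).

NOT CLAIMED: closed forms for `R ≥ 3`; rates; anything numerical beyond the displayed constants.
-/

namespace Summit.Ventures.LatticeQCDFlow.Exactness.GeneralNCMC

open MeasureTheory ProbabilityTheory Set Filter Topology Finset
open scoped ENNReal NNReal Topology

/-! ## §1 `R` replicas: the limiting coverage is the Student-ratio probability -/

section IndepRuns

variable {ι : Type*} [Fintype ι] [DecidableEq ι] [Nontrivial ι] {Ω : ι → Type*}
  [∀ r, MeasurableSpace (Ω r)] {P : (r : ι) → Measure (Ω r)} [∀ r, IsProbabilityMeasure (P r)]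

/-- **THE "INDEPENDENT RUNS" ERROR BAR HAS STUDENT COVERAGE**: `R ≥ 2` independent runs of ANY
estimator with `√n (θ̂_{r,n} − θ) ⇒ N(0, v)` (same `v ≠ 0`); for every `q ≥ 0` the coverage of
`θ̄̂_n ± q √(Σ_r (θ̂_{r,n} − θ̄̂_n)²/(R(R−1)))` converges to
`N(0,1)^{⊗R}{z | |z_{r₀}| ≤ q √((Σ_{r ≠ r₀} z_r²)/(R−1))}`. -/
theorem tendsto_measure_abs_studentised_le_studentRatio_of_indep {θhat : (r : ι) → ℕ → Ω r → ℝ}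
    (hθ : ∀ r n, Measurable (θhat r n)) (θ : ℝ) {v : ℝ≥0} (hv : v ≠ 0)
    (h : ∀ r, TendstoInDistribution (fun (n : ℕ) ω => Real.sqrt (n : ℝ) * (θhat r n ω - θ)) atTop id
      (fun _ => P r) (gaussianReal 0 v))
    (r₀ : ι) {q : ℝ} (hq : 0 ≤ q) :
    Tendsto (fun n : ℕ => Measure.pi P {ω : (r : ι) → Ω r |
        |((∑ r, θhat r n (ω r)) / Fintype.card ι - θ)
          / Real.sqrt ((∑ r, (θhat r n (ω r) - (∑ r', θhat r' n (ω r')) / Fintype.card ι) ^ 2)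
            / ((Fintype.card ι : ℝ) * (Fintype.card ι - 1)))| ≤ q}) atTop
      (𝓝 ((Measure.pi fun _ : ι => gaussianReal 0 1) {z : ι → ℝ |
        |z r₀| ≤ q * Real.sqrt ((∑ r ∈ univ.erase r₀, z r ^ 2) / ((Fintype.card ι : ℝ) - 1))})) := by
  rw [← pi_gaussianReal_measure_abs_tStat_le_eq_studentRatio r₀ one_ne_zero q]
  exact tendsto_measure_abs_studentised_le_of_indep hθ θ hv h hq

end IndepRuns

section Chains

variable {S : Type*} [MeasurableSpace S]
  {κ : Kernel S S} [IsMarkovKernel κ] {π : Measure S} [IsProbabilityMeasure π]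
  {ν : Measure S} [IsProbabilityMeasure ν] {ε : ℝ≥0∞} {m : ℕ}
  {ι : Type*} [Fintype ι] [DecidableEq ι] [Nontrivial ι]

/-- **THE REPLICA-`t` BAR OF `R ≥ 2` INDEPENDENT CHAINS FROM ANY STARTS HAS STUDENT COVERAGE**:
`κ` Markov, `π` invariant, `(nHit κ m)(z,·) ≥ ε ν` (`ε ≠ 0`, `0 < m`), `|f| ≤ C`, `σ²_f > 0`,
`q ≥ 0`: `P(|t_n| ≤ q) → N(0,1)^{⊗R}{z | |z_{r₀}| ≤ q √((Σ_{r ≠ r₀} z_r²)/(R−1))}`. -/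
theorem tendsto_measure_abs_replicaTStat_le_studentRatio_of_nHit (hπ : Kernel.Invariant κ π)
    (hε : ε ≠ 0) (hmin : ∀ z, ε • ν ≤ nHit κ m z) (hm : 0 < m)
    {f : S → ℝ} (hf : Measurable f) {C : ℝ} (hC : ∀ x, |f x| ≤ C)
    (hσ : 0 < Scoring.autocov κ π (fun y => f y - ∫ z, f z ∂π) 0
          + 2 * ∑' t, Scoring.autocov κ π (fun y => f y - ∫ z, f z ∂π) (t + 1))
    (μ : ι → Measure S) [∀ r, IsProbabilityMeasure (μ r)]
    [∀ r, IsProbabilityMeasure (Kernel.trajMeasure (X := fun _ : ℕ => S) (μ r)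
        (fun n : ℕ => κ.comap (fun hh : (i : ↥(Finset.Iic n)) → S => hh ⟨n, Finset.mem_Iic.2 le_rfl⟩)
          (measurable_pi_apply _)))] (r₀ : ι) {q : ℝ} (hq : 0 ≤ q) :
    Tendsto (fun n : ℕ => (Measure.pi fun r => Kernel.trajMeasure (X := fun _ : ℕ => S) (μ r)
        (fun n : ℕ => κ.comap (fun hh : (i : ↥(Finset.Iic n)) → S => hh ⟨n, Finset.mem_Iic.2 le_rfl⟩)
          (measurable_pi_apply _)))
        {x : ι → ℕ → S | |((∑ r, (∑ t ∈ range n, f (x r t)) / n) / Fintype.card ι - ∫ z, f z ∂π)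
          / Real.sqrt ((∑ r, ((∑ t ∈ range n, f (x r t)) / n
              - (∑ r', (∑ t ∈ range n, f (x r' t)) / n) / Fintype.card ι) ^ 2)
              / ((Fintype.card ι : ℝ) * (Fintype.card ι - 1)))| ≤ q})
      atTop
      (𝓝 ((Measure.pi fun _ : ι => gaussianReal 0 1) {z : ι → ℝ |
        |z r₀| ≤ q * Real.sqrt ((∑ r ∈ univ.erase r₀, z r ^ 2) / ((Fintype.card ι : ℝ) - 1))})) := by
  rw [← pi_gaussianReal_measure_abs_tStat_le_eq_studentRatio r₀ one_ne_zero q]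
  exact tendsto_measure_abs_replicaTStat_le_of_nHit hπ hε hmin hm hf hC hσ μ hq

end Chains

/-! ## §2 Two replicas: `L_2(q) = (2/π)·arctan q` -/

section Two

variable {ι : Type*} [Fintype ι] [DecidableEq ι]

omit [DecidableEq ι] in
/-- Two coordinates of a product of probability laws: the event `{|z_{r₀}| ≤ q |z_{r₁}|}` (`r₀ ≠ r₁`)
has the probability the pair law `μ_{r₀} ⊗ μ_{r₁}` gives to the cone `{|x| ≤ q |y|}`. -/
theorem pi_measure_abs_eval_le_mul_abs_eval {μ : ι → Measure ℝ} [∀ i, IsProbabilityMeasure (μ i)]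
    {r₀ r₁ : ι} (h : r₀ ≠ r₁) (q : ℝ) :
    Measure.pi μ {z : ι → ℝ | |z r₀| ≤ q * |z r₁|}
      = ((μ r₀).prod (μ r₁)) {p : ℝ × ℝ | |p.1| ≤ q * |p.2|} := by
  have hA : MeasurableSet {p : ℝ × ℝ | |p.1| ≤ q * |p.2|} :=
    measurableSet_le measurable_fst.abs (measurable_snd.abs.const_mul q)
  -- the pair `(z_{r₀}, z_{r₁})` has law `μ_{r₀} ⊗ μ_{r₁}` (independent coordinates)
  have hind : IndepFun (fun z : ι → ℝ => z r₀) (fun z : ι → ℝ => z r₁) (Measure.pi μ) := by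
    have h0 : iIndepFun (fun i (z : ι → ℝ) => z i) (Measure.pi μ) :=
      iIndepFun_pi (X := fun _ => id) fun _ => aemeasurable_id
    exact h0.indepFun h
  have hpair : (Measure.pi μ).map (fun z : ι → ℝ => (z r₀, z r₁)) = (μ r₀).prod (μ r₁) := by
    rw [(indepFun_iff_map_prod_eq_prod_map_map (measurable_pi_apply r₀).aemeasurable
      (measurable_pi_apply r₁).aemeasurable).1 hind, (measurePreserving_eval μ r₀).map_eq,
      (measurePreserving_eval μ r₁).map_eq]
  rw [← hpair, Measure.map_apply ((measurable_pi_apply r₀).prodMk (measurable_pi_apply r₁)) hA]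
  rfl

/-- With `card ι = 2` and `r₁ ≠ r₀`: `Σ_{r ≠ r₀} z_r² = z_{r₁}²`. -/
theorem sum_sq_erase_eq_sq_of_card_eq_two (hcard : Fintype.card ι = 2) {r₀ r₁ : ι} (h : r₀ ≠ r₁)
    (z : ι → ℝ) : ∑ r ∈ univ.erase r₀, z r ^ 2 = z r₁ ^ 2 := by
  have hset : univ.erase r₀ = {r₁} := by
    apply Finset.eq_singleton_iff_unique_mem.2
    refine ⟨Finset.mem_erase.2 ⟨h.symm, mem_univ _⟩, fun r hr => ?_⟩
    have hr0 : r ≠ r₀ := (Finset.mem_erase.1 hr).1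
    by_contra hr1
    -- three distinct elements in a type of cardinality two
    have : Fintype.card ι ≥ 3 := by
      have hsub : ({r₀, r₁, r} : Finset ι).card ≤ Fintype.card ι := Finset.card_le_univ _
      rw [Finset.card_insert_of_notMem (by simp [h, Ne.symm hr0]),
        Finset.card_insert_of_notMem (by simp [Ne.symm hr1]), Finset.card_singleton] at hsub
      omega
    omega
  rw [hset, Finset.sum_singleton]

/-- **`L_2(q) = (2/π)·arctan q`**: for `card ι = 2`, `v ≠ 0`, `q ≥ 0`,
`N(0,v)^{⊗ι}{|t| ≤ q} = (2/π)·arctan q` (the two-replica `t`-statistic has the symmetric Cauchy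
limit law). -/
theorem pi_gaussianReal_measure_abs_tStat_le_eq_arctan (hcard : Fintype.card ι = 2) {v : ℝ≥0}
    (hv : v ≠ 0) {q : ℝ} (hq : 0 ≤ q) :
    (Measure.pi fun _ : ι => gaussianReal 0 v) {z : ι → ℝ | |(∑ r, z r) / Fintype.card ι
        / Real.sqrt ((∑ r, (z r - (∑ r', z r') / Fintype.card ι) ^ 2)
            / ((Fintype.card ι : ℝ) * (Fintype.card ι - 1)))| ≤ q}
      = ENNReal.ofReal (2 / Real.pi * Real.arctan q) := by
  have hnt : Nontrivial ι := Fintype.one_lt_card_iff_nontrivial.1 (by omega)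
  obtain ⟨r₀, r₁, h⟩ := exists_pair_ne ι
  rw [pi_gaussianReal_measure_abs_tStat_le_eq_studentRatio r₀ hv q]
  have hset : {z : ι → ℝ | |z r₀| ≤ q * Real.sqrt ((∑ r ∈ univ.erase r₀, z r ^ 2)
      / ((Fintype.card ι : ℝ) - 1))} = {z : ι → ℝ | |z r₀| ≤ q * |z r₁|} := by
    ext z
    simp only [mem_setOf_eq, sum_sq_erase_eq_sq_of_card_eq_two hcard h, hcard, Nat.cast_ofNat]
    norm_num [Real.sqrt_sq_eq_abs]
  rw [hset, pi_measure_abs_eval_le_mul_abs_eval h, gaussianReal_prod_measure_abs_le_mul_abs hq]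

end Two

/-! ## §3 Two independent chains from any starts: `P(|t_n| ≤ q) → (2/π)·arctan q`; calibration `q = tan(π(1−α)/2)` -/

section TwoChains

variable {S : Type*} [MeasurableSpace S]
  {κ : Kernel S S} [IsMarkovKernel κ] {π : Measure S} [IsProbabilityMeasure π]
  {ν : Measure S} [IsProbabilityMeasure ν] {ε : ℝ≥0∞} {m : ℕ}
  {ι : Type*} [Fintype ι] [DecidableEq ι]

/-- **TWO REPLICAS, ANY STARTS: `P(|t_n| ≤ q) → (2/π)·arctan q`.**  `κ` Markov, `π` invariant,
Doeblin power, `|f| ≤ C`, `σ²_f > 0`, `card ι = 2` independent chains with initial laws `μ_r`,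
`q ≥ 0`; `t_n = (ȳ̄_n − πf)/√(Σ_r (ȳ_{r,n} − ȳ̄_n)²/2)` (`= (ȳ_{1,n} + ȳ_{2,n} − 2πf)/|ȳ_{1,n} − ȳ_{2,n}|`). -/
theorem tendsto_measure_abs_replicaTStat_le_arctan_of_nHit (hcard : Fintype.card ι = 2)
    (hπ : Kernel.Invariant κ π) (hε : ε ≠ 0) (hmin : ∀ z, ε • ν ≤ nHit κ m z) (hm : 0 < m)
    {f : S → ℝ} (hf : Measurable f) {C : ℝ} (hC : ∀ x, |f x| ≤ C)
    (hσ : 0 < Scoring.autocov κ π (fun y => f y - ∫ z, f z ∂π) 0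
          + 2 * ∑' t, Scoring.autocov κ π (fun y => f y - ∫ z, f z ∂π) (t + 1))
    (μ : ι → Measure S) [∀ r, IsProbabilityMeasure (μ r)]
    [∀ r, IsProbabilityMeasure (Kernel.trajMeasure (X := fun _ : ℕ => S) (μ r)
        (fun n : ℕ => κ.comap (fun hh : (i : ↥(Finset.Iic n)) → S => hh ⟨n, Finset.mem_Iic.2 le_rfl⟩)
          (measurable_pi_apply _)))] {q : ℝ} (hq : 0 ≤ q) :
    Tendsto (fun n : ℕ => (Measure.pi fun r => Kernel.trajMeasure (X := fun _ : ℕ => S) (μ r)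
        (fun n : ℕ => κ.comap (fun hh : (i : ↥(Finset.Iic n)) → S => hh ⟨n, Finset.mem_Iic.2 le_rfl⟩)
          (measurable_pi_apply _)))
        {x : ι → ℕ → S | |((∑ r, (∑ t ∈ range n, f (x r t)) / n) / Fintype.card ι - ∫ z, f z ∂π)
          / Real.sqrt ((∑ r, ((∑ t ∈ range n, f (x r t)) / n
              - (∑ r', (∑ t ∈ range n, f (x r' t)) / n) / Fintype.card ι) ^ 2)
              / ((Fintype.card ι : ℝ) * (Fintype.card ι - 1)))| ≤ q})
      atTop (𝓝 (ENNReal.ofReal (2 / Real.pi * Real.arctan q))) := by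
  have hnt : Nontrivial ι := Fintype.one_lt_card_iff_nontrivial.1 (by omega)
  rw [← pi_gaussianReal_measure_abs_tStat_le_eq_arctan hcard one_ne_zero hq]
  exact tendsto_measure_abs_replicaTStat_le_of_nHit hπ hε hmin hm hf hC hσ μ hq

/-- **…AND IT IS CALIBRATED BY `q = tan(π(1 − α)/2)`**: for `α ∈ (0,1)`,
`P(|t_n| ≤ tan(π(1−α)/2)) → 1 − α` (two replicas; `tan(0.95·π/2) = 12.706…`). -/
theorem tendsto_measure_abs_replicaTStat_le_tan_of_nHit (hcard : Fintype.card ι = 2)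
    (hπ : Kernel.Invariant κ π) (hε : ε ≠ 0) (hmin : ∀ z, ε • ν ≤ nHit κ m z) (hm : 0 < m)
    {f : S → ℝ} (hf : Measurable f) {C : ℝ} (hC : ∀ x, |f x| ≤ C)
    (hσ : 0 < Scoring.autocov κ π (fun y => f y - ∫ z, f z ∂π) 0
          + 2 * ∑' t, Scoring.autocov κ π (fun y => f y - ∫ z, f z ∂π) (t + 1))
    (μ : ι → Measure S) [∀ r, IsProbabilityMeasure (μ r)]
    [∀ r, IsProbabilityMeasure (Kernel.trajMeasure (X := fun _ : ℕ => S) (μ r)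
        (fun n : ℕ => κ.comap (fun hh : (i : ↥(Finset.Iic n)) → S => hh ⟨n, Finset.mem_Iic.2 le_rfl⟩)
          (measurable_pi_apply _)))] {α : ℝ} (hα : α ∈ Ioo (0 : ℝ) 1) :
    Tendsto (fun n : ℕ => (Measure.pi fun r => Kernel.trajMeasure (X := fun _ : ℕ => S) (μ r)
        (fun n : ℕ => κ.comap (fun hh : (i : ↥(Finset.Iic n)) → S => hh ⟨n, Finset.mem_Iic.2 le_rfl⟩)
          (measurable_pi_apply _)))
        {x : ι → ℕ → S | |((∑ r, (∑ t ∈ range n, f (x r t)) / n) / Fintype.card ι - ∫ z, f z ∂π)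
          / Real.sqrt ((∑ r, ((∑ t ∈ range n, f (x r t)) / n
              - (∑ r', (∑ t ∈ range n, f (x r' t)) / n) / Fintype.card ι) ^ 2)
              / ((Fintype.card ι : ℝ) * (Fintype.card ι - 1)))| ≤ Real.tan (Real.pi * (1 - α) / 2)})
      atTop (𝓝 (ENNReal.ofReal (1 - α))) := by
  have hnt : Nontrivial ι := Fintype.one_lt_card_iff_nontrivial.1 (by omega)
  obtain ⟨r₀, r₁, h⟩ := exists_pair_ne ι
  have h1 : 0 < Real.pi * (1 - α) / 2 := by have := hα.2; positivity
  have h2 : Real.pi * (1 - α) / 2 < Real.pi / 2 := by nlinarith [hα.1, Real.pi_pos]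
  have hq : 0 ≤ Real.tan (Real.pi * (1 - α) / 2) := Real.tan_nonneg_of_nonneg_of_le_pi_div_two h1.le h2.le
  have hlim : (Measure.pi fun _ : ι => gaussianReal 0 1) {z : ι → ℝ | |(∑ r, z r) / Fintype.card ι
        / Real.sqrt ((∑ r, (z r - (∑ r', z r') / Fintype.card ι) ^ 2)
            / ((Fintype.card ι : ℝ) * (Fintype.card ι - 1)))| ≤ Real.tan (Real.pi * (1 - α) / 2)}
      = ENNReal.ofReal (1 - α) := by
    rw [pi_gaussianReal_measure_abs_tStat_le_eq_studentRatio r₀ one_ne_zero]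
    have hset : {z : ι → ℝ | |z r₀| ≤ Real.tan (Real.pi * (1 - α) / 2) * Real.sqrt ((∑ r ∈ univ.erase r₀, z r ^ 2)
        / ((Fintype.card ι : ℝ) - 1))} = {z : ι → ℝ | |z r₀| ≤ Real.tan (Real.pi * (1 - α) / 2) * |z r₁|} := by
      ext z
      simp only [mem_setOf_eq, sum_sq_erase_eq_sq_of_card_eq_two hcard h, hcard, Nat.cast_ofNat]
      norm_num [Real.sqrt_sq_eq_abs]
    rw [hset, pi_measure_abs_eval_le_mul_abs_eval h, gaussianReal_prod_measure_abs_le_mul_abs_tan hα]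
  rw [← hlim]
  exact tendsto_measure_abs_replicaTStat_le_of_nHit hπ hε hmin hm hf hC hσ μ hq

end TwoChains

end Summit.Ventures.LatticeQCDFlow.Exactness.GeneralNCMC
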